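import Summits.BirchSwinnertonDyer.BirchSwinnertonDyer.Theorems.ManinLocalTwoThreeCurveExclusionOneHundredEight
import HarnessLib

/-!
# Level `112 = 2⁴·7` (C2 domain, `v₂(N) = 4`, genus 11, three classes `112a`, `112b`, `112c`): the CURVE-SIDE EXCLUSION ARITHMETIC

Cell `bsd-f2-manin`, route `ManinLocalTwoThree`, crux C2 `ManinOddAtFour` (stmt-BirchSwinnertonDyer-22967, `2² ∣ 112`), prover seat p1 gen 25;
`--supports stmt-BirchSwinnertonDyer-22967` (helper).  Level-`112` analogue of `…CurveExclusionOneHundredEight` (generic curve-side lemmas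
`lFunction_mul`, `neg_le_lFunction_prime_and_le` from the level-`44` file, `lFunction_fortyNine` from the level-`108` file).

THE PLAN AT 112 (an g51 MEMO-an §96, `S₂`-variant).  On an g51's `η`-basis `B1c…B11c` of `S₂(Γ₀(112))` (pivot columns `1,…,11`) the reduced
row-echelon form gives, among others, the six column relations
`a₁₅ = −2a₃ − 4a₇ + a₁₁`, `a₂₁ = −a₁ − a₅ − a₉`, `a₃₃ = 0`, `a₃₅ = −a₃ − 2a₇ + a₁₁`, `a₄₉ = a₁`, `a₅₅ = 2a₁₁` for EVERY `f ∈ S₂(Γ₀(112))`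
(`…ColumnRelationsOneTwelve.columnRelations_oneTwelve`).  THIS FILE proves the arithmetic consequence for an elliptic `W/ℚ` with `7 ∣ N_W`
(true for every `X₀(112)`-datum: `7 ∣ 112`, tree `IsNewformOf.dvd_level_iff_dvd_conductorNorm`) whose `L`-coefficients satisfy them:
`(a₃, a₅, a₇, a₉, a₁₁)` is one of SIX vectors — the newforms `112a (−2,−4,−1,1,0)`, `112b (0,2,1,−3,4)`, `112c (2,0,−1,1,0)` and the OLD
forms «odd part of `14a`» `(−2,0,1,1,0)`, `ι₁(56a) (0,2,−1,−3,−4)`, `ι₁(56b) (2,−4,1,1,0)` (excluded downstream by `old ⊓ new = ⊥`; `14a` itself,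
with `a₂ = −1`, never meets the curve side `a₂ = 0`).  Inputs: `a₁ = 1`; `a₄₉ = a₇²` (`7 ∣ N_W`) ⟹ `a₇ = ±1`; multiplicativity
`a₁₅ = a₃a₅`, `a₂₁ = a₃a₇`, `a₃₃ = a₃a₁₁`, `a₃₅ = a₅a₇`, `a₅₅ = a₅a₁₁`; Hasse at `5, 7` — all PROVED tree theorems.
(`a₃a₁₁ = 0` and `(a₅ − 2)a₁₁ = 0` split `a₁₁ = 0` / `a₃ = 0 ∧ a₅ = 2`; the rest is linear after `a₇ = ±1`.)  Exact twin: `HOME/p1/g25/genlevel.py`.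

HONEST FRAMING: elementary and unconditional; nothing here proves C2, Manin's conjecture or BSD.
[cite: DiamondShurman2005, §8.8 (8.44)] [cite: SilvermanAEC2009, Thm. V.1.1] [cite: CremonaAlgorithms1997, Table 3 (N = 14, 56, 112)]
-/

set_option autoImplicit false
-- lint-debt: the directory name repeats the summit name (sibling precedent `ManinLocalTwoThreeCurveExclusionOneHundredEight.lean`)
set_option linter.dupNamespace false

namespace Summit.BirchSwinnertonDyer.BirchSwinnertonDyer.Theorems.ManinLocalTwoThree.LevelOneTwelve

open Literature.NumberTheory.EllipticCurves

variable (W : WeierstrassCurve ℚ) [W.IsElliptic]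

/-- Hasse at `5, 7`: `|a₅| ≤ 4`, `|a₇| ≤ 5` (two-sided form). [cite: SilvermanAEC2009, Thm. V.1.1] -/
theorem hasse_bounds_oneTwelve : (-4 ≤ W.LFunction 5 ∧ W.LFunction 5 ≤ 4) ∧ (-5 ≤ W.LFunction 7 ∧ W.LFunction 7 ≤ 5) :=
  ⟨by exact_mod_cast LevelFortyFour.neg_le_lFunction_prime_and_le W (p := 5) (B := 4) (by norm_num) (by norm_num),
   by exact_mod_cast LevelFortyFour.neg_le_lFunction_prime_and_le W (p := 7) (B := 5) (by norm_num) (by norm_num)⟩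

/-- **The level-112 exclusion arithmetic.**  If `7 ∣ N_W` and the `L`-coefficients of an elliptic `W/ℚ` satisfy the six column relations
`a₁₅ = −2a₃ − 4a₇ + a₁₁`, `a₂₁ = −a₁ − a₅ − a₉`, `a₃₃ = 0`, `a₃₅ = −a₃ − 2a₇ + a₁₁`, `a₄₉ = a₁`, `a₅₅ = 2a₁₁` of `S₂(Γ₀(112))`, then
`(a₃, a₅, a₇, a₉, a₁₁)` is `112a`'s, `112b`'s, `112c`'s, or one of the three old vectors (odd part of `14a`, `56a`, `56b`).
[cite: DiamondShurman2005, §8.8 (8.44)] [cite: CremonaAlgorithms1997, Table 3 (N = 14, 56, 112)] -/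
theorem coeffVector_oneTwelve (h7N : 7 ∣ W.conductorNorm ℤ)
    (h15 : W.LFunction 15 = -2 * W.LFunction 3 - 4 * W.LFunction 7 + W.LFunction 11)
    (h21 : W.LFunction 21 = -W.LFunction 1 - W.LFunction 5 - W.LFunction 9)
    (h33 : W.LFunction 33 = 0)
    (h35 : W.LFunction 35 = -W.LFunction 3 - 2 * W.LFunction 7 + W.LFunction 11)
    (h49 : W.LFunction 49 = W.LFunction 1)
    (h55 : W.LFunction 55 = 2 * W.LFunction 11) :
    (W.LFunction 3 = -2 ∧ W.LFunction 5 = -4 ∧ W.LFunction 7 = -1 ∧ W.LFunction 9 = 1 ∧ W.LFunction 11 = 0) ∨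
      (W.LFunction 3 = 0 ∧ W.LFunction 5 = 2 ∧ W.LFunction 7 = 1 ∧ W.LFunction 9 = -3 ∧ W.LFunction 11 = 4) ∨
      (W.LFunction 3 = 2 ∧ W.LFunction 5 = 0 ∧ W.LFunction 7 = -1 ∧ W.LFunction 9 = 1 ∧ W.LFunction 11 = 0) ∨
      (W.LFunction 3 = -2 ∧ W.LFunction 5 = 0 ∧ W.LFunction 7 = 1 ∧ W.LFunction 9 = 1 ∧ W.LFunction 11 = 0) ∨
      (W.LFunction 3 = 0 ∧ W.LFunction 5 = 2 ∧ W.LFunction 7 = -1 ∧ W.LFunction 9 = -3 ∧ W.LFunction 11 = -4) ∨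
      (W.LFunction 3 = 2 ∧ W.LFunction 5 = -4 ∧ W.LFunction 7 = 1 ∧ W.LFunction 9 = 1 ∧ W.LFunction 11 = 0) := by
  obtain ⟨⟨h5l, h5u⟩, ⟨h7l, h7u⟩⟩ := hasse_bounds_oneTwelve W
  have hL1 : W.LFunction 1 = 1 := W.LFunction_apply_one
  -- multiplicativity at `15, 21, 33, 35, 55` and the `7`-power recursion
  have m15 : W.LFunction 15 = W.LFunction 3 * W.LFunction 5 := LevelFortyFour.lFunction_mul W (m := 3) (n := 5) (by norm_num)
  have m21 : W.LFunction 21 = W.LFunction 3 * W.LFunction 7 := LevelFortyFour.lFunction_mul W (m := 3) (n := 7) (by norm_num)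
  have m33 : W.LFunction 33 = W.LFunction 3 * W.LFunction 11 :=
    LevelFortyFour.lFunction_mul W (m := 3) (n := 11) (by norm_num)
  have m35 : W.LFunction 35 = W.LFunction 5 * W.LFunction 7 := LevelFortyFour.lFunction_mul W (m := 5) (n := 7) (by norm_num)
  have m55 : W.LFunction 55 = W.LFunction 5 * W.LFunction 11 :=
    LevelFortyFour.lFunction_mul W (m := 5) (n := 11) (by norm_num)
  have r49 := LevelOneHundredEight.lFunction_fortyNine W
  rw [if_pos h7N, sub_zero] at r49
  -- name the coefficients
  rw [hL1] at h21 h49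
  rw [r49] at h49
  set a3 := W.LFunction 3 with ha3
  set a5 := W.LFunction 5 with ha5
  set a7 := W.LFunction 7 with ha7
  set a9 := W.LFunction 9 with ha9
  set a11 := W.LFunction 11 with ha11
  clear_value a3 a5 a7 a9 a11
  rw [m15] at h15
  rw [m21] at h21
  rw [m33] at h33
  rw [m35] at h35
  rw [m55] at h55
  -- Step 1: `a₇² = 1`
  have h7v : a7 = 1 ∨ a7 = -1 := by
    clear h15 h21 h33 h35 h55
    interval_cases a7 <;> omega
  by_cases h11 : a11 = 0
  · -- Step 2a: `a₁₁ = 0`: `a₅a₇ = −a₃ − 2a₇`, `a₃a₅ = −2a₃ − 4a₇` ⟹ `a₅(a₅ + 4) = 0`; `a₉` from `a₃a₇ = −1 − a₅ − a₉`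
    subst h11
    rcases h7v with h7 | h7 <;> subst h7
    · have h5v : a5 = 0 ∨ a5 = -4 := by
        have h3 : a3 = -a5 - 2 := by linear_combination h35
        subst h3
        interval_cases a5 <;> omega
      rcases h5v with h5 | h5 <;> subst h5
      · obtain ⟨h3, h9⟩ : a3 = -2 ∧ a9 = 1 := by omega
        subst h3 h9; norm_num
      · obtain ⟨h3, h9⟩ : a3 = 2 ∧ a9 = 1 := by omega
        subst h3 h9; norm_num
    · have h5v : a5 = 0 ∨ a5 = -4 := by
        have h3 : a3 = a5 + 2 := by linear_combination h35
        subst h3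
        interval_cases a5 <;> omega
      rcases h5v with h5 | h5 <;> subst h5
      · obtain ⟨h3, h9⟩ : a3 = 2 ∧ a9 = 1 := by omega
        subst h3 h9; norm_num
      · obtain ⟨h3, h9⟩ : a3 = -2 ∧ a9 = 1 := by omega
        subst h3 h9; norm_num
  · -- Step 2b: `a₁₁ ≠ 0`: `a₃a₁₁ = 0` ⟹ `a₃ = 0`; `(a₅ − 2)a₁₁ = 0` ⟹ `a₅ = 2`; then `a₁₁ = 4a₇`, `a₉ = −3`
    have h3 : a3 = 0 := by
      rcases mul_eq_zero.mp h33 with h | h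
      · exact h
      · exact absurd h h11
    have h5 : a5 = 2 := by
      have h0 : (a5 - 2) * a11 = 0 := by linear_combination h55
      rcases mul_eq_zero.mp h0 with h | h
      · linear_combination h
      · exact absurd h h11
    subst h3 h5
    rcases h7v with h7 | h7 <;> subst h7
    · obtain ⟨h9, h11v⟩ : a9 = -3 ∧ a11 = 4 := by omega
      subst h9 h11v; norm_num
    · obtain ⟨h9, h11v⟩ : a9 = -3 ∧ a11 = -4 := by omega
      subst h9 h11v; norm_num

end Summit.BirchSwinnertonDyer.BirchSwinnertonDyer.Theorems.ManinLocalTwoThree.LevelOneTwelve
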